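import Summits.CriticalPhenomena.PercolationContinuityZ3.Theorems.PercNearOneGluingNoHeavyLowerTailSahiCombFiveUpSetProof

/-!
# A UNIVERSAL Kleitman matching, part I: the passage graph `G*(B,X)` and its Hall condition

Support file of the one-cut programme (crux `NoHeavyLowerTail`, stmt-CriticalPhenomena-4575; lemma factory `prim-lf-1` gen 35,
memo `FROM-prim-lf-1-gen35-SPLICE-FORM-AND-HYBRID-LAW.md` §2; companion of `…FiveUpSetPassage` (part II) and `…FiveUpSetSplice`).
Cell `prim-masterthm` seat P5 (gen 20, memo COMBO1 §6(3)) asked for the matching (Hall) structure behind the five-up-set inequality.  Its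
three-set face (hybrid Kleitman (★3′), `FiveUpSet.hybridKleitmanIneq_holds`) is a ONE-PARAMETER FAMILY of Hall statements (one per cut).
Parts I–II show that the whole family is the Hall condition of a SINGLE bipartite graph and hence, on cubes, a theorem about ONE matching.

Fix up-sets `B, X` of a finite cube; `T := B ∩ X` (targets), `S := B ∩ refl X` (sources), `O := refl T \ B` (antipodes of targets outside `B`),
`Q := S \ refl T` (sources that are not antipodes of targets).  THE PASSAGE GRAPH `G*(B,X)`: left vertices `O ⊔ S`, right vertices
`Q × {false} ⊔ T × {true}`, edges `o → (q,false)` for `o ∈ O`, `o ⊆ q` (a point outside `B` may "thread" a point of `Q`), and `a → (t,true)` for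
`a ⊆ t ∈ T`.  This file:
* `card_inter_sdiff_add` (bookkeeping), `isLowerSet_univ_sdiff'`;
* `passage_hall_ineq` — for up-sets `V₁ ⊆ V₂`: `#(V₁ ∩ O) + #(V₂ ∩ S) ≤ #(V₁ ∩ Q) + #(V₂ ∩ T)`; this IS the hybrid Kleitman inequality for `V₂`
  with the cut `univ \ V₁` (equivalently the nested splice inequality of `…FiveUpSetSplice`), since `#(V₁ ∩ O) − #(V₁ ∩ Q) =
  #(V₁ ∩ refl T) − #(V₁ ∩ S)`;
* **`passage_hall_condition`** — every finite set of left vertices of `G*(B,X)` has at least as many neighbours (with `V₁` the up-closure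
  of its `O`-part and `V₂` that of the whole set, the neighbourhood contains `(V₁ ∩ Q) × {false} ⊔ (V₂ ∩ T) × {true}`).
Part II applies Hall's theorem and a counting argument (`#O + #S = #Q + #T`) to get the perfect matching = the passage form / universal matching.
HONEST LABEL: lemmas toward a reformulation of an already-proved cube theorem; nothing here advances `TriWIneq` (a ≥ 2). [this work]
-/

namespace Summit.CriticalPhenomena.PercolationContinuityZ3.Theorems

namespace FiveUpSet

open Finset

variable {α : Type} [DecidableEq α] [Fintype α]

/-! ### Counting identities for the four token sets -/

omit [Fintype α] in
/-- `#(V ∩ (R \ B)) + #(V ∩ R ∩ B) = #(V ∩ R)`. [this work] -/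
theorem card_inter_sdiff_add (V R B : Finset (Finset α)) :
    (V ∩ (R \ B)).card + (V ∩ R ∩ B).card = (V ∩ R).card := by
  have e : V ∩ R = (V ∩ (R \ B)) ∪ (V ∩ R ∩ B) := by
    ext s; simp only [mem_inter, mem_union, mem_sdiff]; tauto
  have d : Disjoint (V ∩ (R \ B)) (V ∩ R ∩ B) := by
    rw [disjoint_left]; intro s hs hs'
    simp only [mem_inter, mem_sdiff] at hs hs'
    exact hs.2.2 hs'.2
  rw [← card_union_of_disjoint d, ← e]

/-- The complement of an up-set is a down-set (as a `Finset` of the cube). [this work] -/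
theorem isLowerSet_univ_sdiff' {U : Finset (Finset α)} (hU : IsUpperSet (U : Set (Finset α))) :
    IsLowerSet ((univ \ U : Finset (Finset α)) : Set (Finset α)) := by
  intro s t hts hs
  rw [mem_coe, mem_sdiff] at hs ⊢
  exact ⟨mem_univ _, fun ht => hs.2 (hU hts ht)⟩

/-- **The Hall inequality of the passage graph** (= the hybrid Kleitman inequality (★3′) with the cut `univ \ V₁`, i.e. the nested SPLICE
inequality of the companion file `…FiveUpSetSplice`): for up-sets `V₁ ⊆ V₂`, `B`, `X`,
`#(V₁ ∩ (refl (B ∩ X) \ B)) + #(V₂ ∩ (B ∩ refl X)) ≤ #(V₁ ∩ ((B ∩ refl X) \ refl (B ∩ X))) + #(V₂ ∩ (B ∩ X))`. [this work] -/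
theorem passage_hall_ineq (V₁ V₂ B X : Finset (Finset α)) (hV₁ : IsUpperSet (V₁ : Set (Finset α)))
    (hV₂ : IsUpperSet (V₂ : Set (Finset α))) (hB : IsUpperSet (B : Set (Finset α))) (hX : IsUpperSet (X : Set (Finset α)))
    (h12 : V₁ ⊆ V₂) :
    (V₁ ∩ (refl (B ∩ X) \ B)).card + (V₂ ∩ (B ∩ refl X)).card
      ≤ (V₁ ∩ ((B ∩ refl X) \ refl (B ∩ X))).card + (V₂ ∩ (B ∩ X)).card := by
  -- hybrid Kleitman for `V₂` with the cut `univ \ V₁`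
  have h := hybridKleitmanIneq_holds α V₂ X B (univ \ V₁) hV₂ hX hB (isLowerSet_univ_sdiff' hV₁)
  rw [card_inter_hybrid] at h
  have e1 : V₂ ∩ refl X ∩ (univ \ V₁) ∩ B = (V₂ \ V₁) ∩ (B ∩ refl X) := by
    ext s; simp only [mem_inter, mem_sdiff, mem_univ, true_and]; tauto
  have e2 : (V₂ ∩ refl X) \ (univ \ V₁) ∩ refl B = V₁ ∩ refl (B ∩ X) := by
    ext s
    simp only [mem_inter, mem_sdiff, mem_univ, true_and, refl_inter, not_not]
    constructor
    · rintro ⟨⟨⟨-, hx⟩, h1⟩, hb⟩; exact ⟨h1, hb, hx⟩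
    · rintro ⟨h1, hb, hx⟩; exact ⟨⟨⟨h12 h1, hx⟩, h1⟩, hb⟩
  have e3 : V₂ ∩ X ∩ B = V₂ ∩ (B ∩ X) := by
    ext s; simp only [mem_inter]; tauto
  rw [e1, e2, e3] at h
  -- split `V₂ ∩ S` along `V₁`, and the two sdiff-sets of `V₁`
  have a0 : (V₂ ∩ (B ∩ refl X)).card = ((V₂ \ V₁) ∩ (B ∩ refl X)).card + (V₁ ∩ (B ∩ refl X)).card := by
    have e : V₂ ∩ (B ∩ refl X) = ((V₂ \ V₁) ∩ (B ∩ refl X)) ∪ (V₁ ∩ (B ∩ refl X)) := by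
      ext s; simp only [mem_inter, mem_union, mem_sdiff]
      constructor
      · rintro ⟨h2, hs⟩
        by_cases h1 : s ∈ V₁
        · exact Or.inr ⟨h1, hs⟩
        · exact Or.inl ⟨⟨h2, h1⟩, hs⟩
      · rintro (⟨⟨h2, -⟩, hs⟩ | ⟨h1, hs⟩)
        · exact ⟨h2, hs⟩
        · exact ⟨h12 h1, hs⟩
    have d : Disjoint ((V₂ \ V₁) ∩ (B ∩ refl X)) (V₁ ∩ (B ∩ refl X)) := by
      rw [disjoint_left]; intro s hs hs'
      simp only [mem_inter, mem_sdiff] at hs hs'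
      exact hs.1.2 hs'.1
    rw [e, card_union_of_disjoint d]
  have a1 := card_inter_sdiff_add V₁ (refl (B ∩ X)) B
  have a2 := card_inter_sdiff_add V₁ (B ∩ refl X) (refl (B ∩ X))
  have e : V₁ ∩ refl (B ∩ X) ∩ B = V₁ ∩ (B ∩ refl X) ∩ refl (B ∩ X) := by
    ext s; simp only [mem_inter, refl_inter]; tauto
  rw [e] at a1
  omega

/-! ### Hall's condition for the passage graph -/

/-- **Hall's condition for the passage graph `G*(B,X)`.**  Left vertices: the points of `O ⊔ S`, `O = refl (B ∩ X) \ B`, `S = B ∩ refl X`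
(as a subtype of the cube); the neighbourhood of `a` consists of the thread points `(q, false)`, `q ∈ Q = S \ refl (B ∩ X)`, `a ⊆ q` (only for
`a ∉ B`) and the targets `(t, true)`, `t ∈ B ∩ X`, `a ⊆ t`.  Every finite set of left vertices has at least as many neighbours: with `V₁` the
up-closure of its `O`-part and `V₂` the up-closure of the whole set, the neighbourhood contains `(V₁ ∩ Q) × {false} ⊔ (V₂ ∩ (B ∩ X)) × {true}`
and `passage_hall_ineq` applies. [this work] -/
theorem passage_hall_condition (B X : Finset (Finset α)) (hB : IsUpperSet (B : Set (Finset α))) (hX : IsUpperSet (X : Set (Finset α))) :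
    ∀ s : Finset {a : Finset α // a ∈ (refl (B ∩ X) \ B) ∪ (B ∩ refl X)},
    s.card ≤ (s.biUnion (fun a =>
      (if a.1 ∈ B then ∅ else (((B ∩ refl X) \ refl (B ∩ X)).filter (fun q => a.1 ⊆ q)).image (fun q => (q, false)))
        ∪ ((B ∩ X).filter (fun t => a.1 ⊆ t)).image (fun t => (t, true)))).card := by
  classical
  set T : Finset (Finset α) := B ∩ X with hT
  set S : Finset (Finset α) := B ∩ refl X with hS
  set O : Finset (Finset α) := refl (B ∩ X) \ B with hO
  set Q : Finset (Finset α) := (B ∩ refl X) \ refl (B ∩ X) with hQ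
  set Lft : Finset (Finset α) := O ∪ S with hLft
  let nb : Finset α → Finset (Finset α × Bool) := fun a =>
    (if a ∈ B then ∅ else (Q.filter (fun q => a ⊆ q)).image (fun q => (q, false)))
      ∪ (T.filter (fun t => a ⊆ t)).image (fun t => (t, true))
  let t : {a : Finset α // a ∈ Lft} → Finset (Finset α × Bool) := fun a => nb a.1
  intro s
  show s.card ≤ (s.biUnion t).card
  -- the underlying set of left vertices and its two parts
  set A : Finset (Finset α) := s.image Subtype.val with hA
  have hAcard : A.card = s.card := card_image_of_injective _ Subtype.val_injective
  have hAsub : A ⊆ Lft := by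
    intro a ha; rw [hA, mem_image] at ha; obtain ⟨x, -, rfl⟩ := ha; exact x.2
  set AO : Finset (Finset α) := A.filter (fun a => a ∉ B) with hAO
  set AS : Finset (Finset α) := A.filter (fun a => a ∈ B) with hAS
  have hAsplit : A.card = AO.card + AS.card := by
    rw [hAO, hAS, add_comm]; exact (card_filter_add_card_filter_not _).symm
  -- up-closures
  set V₁ : Finset (Finset α) := univ.filter (fun x => ∃ o ∈ AO, o ⊆ x) with hV₁
  set V₂ : Finset (Finset α) := univ.filter (fun x => ∃ a ∈ A, a ⊆ x) with hV₂
  have hV₁up : IsUpperSet (V₁ : Set (Finset α)) := by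
    intro x y hxy hx
    rw [mem_coe, hV₁, mem_filter] at hx ⊢
    obtain ⟨-, o, ho, hox⟩ := hx
    exact ⟨mem_univ _, o, ho, hox.trans hxy⟩
  have hV₂up : IsUpperSet (V₂ : Set (Finset α)) := by
    intro x y hxy hx
    rw [mem_coe, hV₂, mem_filter] at hx ⊢
    obtain ⟨-, a, ha, hax⟩ := hx
    exact ⟨mem_univ _, a, ha, hax.trans hxy⟩
  have h12 : V₁ ⊆ V₂ := by
    intro x hx
    rw [hV₁, mem_filter] at hx; rw [hV₂, mem_filter]
    obtain ⟨-, o, ho, hox⟩ := hx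
    rw [hAO, mem_filter] at ho
    exact ⟨mem_univ _, o, ho.1, hox⟩
  -- |A_O| ≤ #(V₁ ∩ O), |A_S| ≤ #(V₂ ∩ S)
  have hAO_le : AO.card ≤ (V₁ ∩ O).card := by
    apply card_le_card
    intro a ha
    have ha' := ha
    rw [hAO, mem_filter] at ha'
    have haL := hAsub ha'.1
    rw [hLft, mem_union] at haL
    rw [mem_inter, hV₁, mem_filter]
    refine ⟨⟨mem_univ _, a, ha, Subset.rfl⟩, ?_⟩
    rcases haL with h | h
    · exact h
    · exfalso; rw [hS, mem_inter] at h; exact ha'.2 h.1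
  have hAS_le : AS.card ≤ (V₂ ∩ S).card := by
    apply card_le_card
    intro a ha
    have ha' := ha
    rw [hAS, mem_filter] at ha'
    have haL := hAsub ha'.1
    rw [hLft, mem_union] at haL
    rw [mem_inter, hV₂, mem_filter]
    refine ⟨⟨mem_univ _, a, ha'.1, Subset.rfl⟩, ?_⟩
    rcases haL with h | h
    · exfalso; rw [hO, mem_sdiff] at h; exact h.2 ha'.2
    · exact h
  -- the neighbourhood contains (Q ∩ V₁) × {false} ⊔ (T ∩ V₂) × {true}
  set N₁ : Finset (Finset α × Bool) := (V₁ ∩ Q).image (fun q => (q, false)) with hN₁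
  set N₂ : Finset (Finset α × Bool) := (V₂ ∩ T).image (fun t => (t, true)) with hN₂
  have hN₁card : N₁.card = (V₁ ∩ Q).card :=
    card_image_of_injective _ (fun a b h => by simpa using congrArg Prod.fst h)
  have hN₂card : N₂.card = (V₂ ∩ T).card :=
    card_image_of_injective _ (fun a b h => by simpa using congrArg Prod.fst h)
  have hNd : Disjoint N₁ N₂ := by
    rw [disjoint_left]; intro p hp hp'
    rw [hN₁, mem_image] at hp; rw [hN₂, mem_image] at hp'
    obtain ⟨q, -, rfl⟩ := hp; obtain ⟨t', -, ht'⟩ := hp'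
    simpa using congrArg Prod.snd ht'
  have hNsub : N₁ ∪ N₂ ⊆ s.biUnion t := by
    intro p hp
    rw [mem_union] at hp
    rw [mem_biUnion]
    rcases hp with hp | hp
    · rw [hN₁, mem_image] at hp
      obtain ⟨q, hq, rfl⟩ := hp
      rw [mem_inter, hV₁, mem_filter] at hq
      obtain ⟨⟨-, o, ho, hoq⟩, hqQ⟩ := hq
      have ho' := ho; rw [hAO, mem_filter] at ho'
      have hoA := ho'.1; rw [hA, mem_image] at hoA
      obtain ⟨x, hxs, hxo⟩ := hoA
      refine ⟨x, hxs, ?_⟩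
      show (q, false) ∈ nb x.1
      rw [hxo]
      simp only [nb, ho'.2, if_false, mem_union, mem_image, mem_filter]
      exact Or.inl ⟨q, ⟨hqQ, hoq⟩, rfl⟩
    · rw [hN₂, mem_image] at hp
      obtain ⟨u, hu, rfl⟩ := hp
      rw [mem_inter, hV₂, mem_filter] at hu
      obtain ⟨⟨-, a, ha, hau⟩, huT⟩ := hu
      have haA := ha; rw [hA, mem_image] at haA
      obtain ⟨x, hxs, hxa⟩ := haA
      refine ⟨x, hxs, ?_⟩
      show (u, true) ∈ nb x.1
      rw [hxa]
      simp only [nb, mem_union, mem_image, mem_filter]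
      exact Or.inr ⟨u, ⟨huT, hau⟩, rfl⟩
  have hNcard : (V₁ ∩ Q).card + (V₂ ∩ T).card ≤ (s.biUnion t).card := by
    rw [← hN₁card, ← hN₂card, ← card_union_of_disjoint hNd]
    exact card_le_card hNsub
  -- the splice inequality
  have key := passage_hall_ineq V₁ V₂ B X hV₁up hV₂up hB hX h12
  rw [← hAcard, hAsplit]
  calc AO.card + AS.card ≤ (V₁ ∩ O).card + (V₂ ∩ S).card := Nat.add_le_add hAO_le hAS_le
    _ ≤ (V₁ ∩ Q).card + (V₂ ∩ T).card := key
    _ ≤ (s.biUnion t).card := hNcard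

end FiveUpSet

end Summit.CriticalPhenomena.PercolationContinuityZ3.Theorems
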